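import Summits.FinalStateConjecture.FinalStateConjecture.Theses.LaminatedThreshold
import Literature.Geometry.Lorentzian.CoordKIDEquations

/-!
# Birth skeleton for crux `LaminatedThreshold.TameExitsLocalise` (stmt-FinalStateConjecture-16894)

planner-skel-stmt-FinalStateConjecture-16894-0 · skeleton-register (BC3, one-shot) · 2026-08-17.
Route `route-FinalStateConjecture-LaminatedThreshold` (rev 0, refutation route
`closes : LaminatedThreshold → TameExitsLocalise → ¬ FinalStateConjecture`), crux #3 (rank 3, OPEN / XL):
TAME EXITS LOCALISE — for every `X` and every admissible EXCEPTIONAL datum `d⋆` (not good: it is false that an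
MGHD exists and every MGHD has complete sojourn-`𝓘⁺` and a sub-extremal, ray-closed, exhaustive, future-oriented
two-Kerr-chart final state decomposition): if some TAME (one fixed sole end `e`, DR rates with continuous mass,
`wDist`-continuous at `0`), immersed, injective, admissible one-parameter family `F` through `d⋆` has all members
`c ≠ 0` good, then some jointly smooth, immersed, injective, admissible family `F'` through `d⋆` which agrees with
`d⋆` outside ONE compact set has all members good on a punctured window `0 < ‖c‖ < ε`.

## The line — the route header's own two-layer plan, typed, plus the residual Killing-tail case

Header (TWO-LAYER PLAN): `TameExitsLocalise ⇐ ParametricCompactGluing → TailRobustOfGoodness`. The cut is along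
the one seam both halves of the literature agree on — the FAR ANNULUS `{R₁ < r < R₂}` of the fixed end `e`:

* S1 `stub_parametricTailGluing` — ELLIPTIC (constraint equations). If `d⋆` has KID-free chart annuli beyond
  every radius (`NoKillingTail e d⋆`), then beyond any prescribed radius `R₀` there is a radius `R₁ ≥ R₀` and a
  jointly smooth, immersed, injective, admissible family `F'` through `d⋆`, equal to `d⋆` off one compact set, and
  equal to the exit member `F c` inside radius `R₁` (off `e.far R₁`) for all small `c` (Chruściel–Delay /
  Corvino–Schoen implicit-function gluing at `d⋆` across a KID-free annulus, parametric in `c`; the data to be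
  glued are `C^∞`-close on the compact annulus by joint smoothness of `F` alone).
* S2 `stub_goodnessTailRobust` — HYPERBOLIC (the analytic heart, the header's `TailRobustOfGoodness`). For a tame
  admissible family `F` through `d⋆` whose members `c ≠ 0` are good there is a THRESHOLD RADIUS `R⋆` such that
  every jointly smooth admissible family `F'` through `d⋆`, equal to `d⋆` off a compact set and equal to `F c`
  inside some `R₁ ≥ R⋆` for small `c`, is good on a punctured window (goodness of `F c` survives replacing its
  tame-small tail by `d⋆`'s own tail: Cauchy stability up to a late hyperboloid + asymptotic stability of the
  settled sub-extremal configuration under the removed small incoming tail; equivalently "exceptionality is decided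
  inside a bounded region, uniformly along the exit").
* S3 `stub_killingTailCase` — the RESIDUAL case `¬ NoKillingTail e d⋆`: beyond some radius EVERY chart annulus of
  `d⋆` carries a non-trivial KID `(N, Y)` (Moncrief: the tail of `d⋆` is a slice of a vacuum end with a Killing
  field — stationary and/or axisymmetric near spatial infinity, Beig–Chruściel). Here annular gluing of `F c` to
  the EXACT tail of `d⋆` is obstructed at linear order by the KID charges (mass / angular momentum read through the
  annulus), so the given tame exit cannot be localised by shell surgery whenever its charges move
  (`M(c) ≠ M(0)`): the line has no teeth and the crux must be won (or LOST — this is where a disprover should aim,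
  cf. the refuter's charge-pinning remark on item 16894) by a different mechanism. It is registered as a stub so
  that the case split is explicit and load-bearing rather than hidden inside S1.

Composition `TameExitsLocalise_of : S1 → S2 → S3 → TameExitsLocalise` is kernel-checked: given the crux's
hypotheses at `(X, d⋆)` with tame exit `(e, F)`, case on `NoKillingTail e d⋆`; in the KID-free case take `R⋆`
from S2, feed `R₀ := R⋆` to S1 to get `R₁ ≥ R⋆` and the glued family `F'` with its core-agreement window, and
read the goodness window off S2 at `R₁`; in the Killing-tail case S3 is the crux there. `tameExitsLocalise_iff`
records that the vocabulary (`Good`) is DEFINITIONALLY the crux's.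

Disproof.lean: none exists for this crux (`ledger crux ls stmt-FinalStateConjecture-16894`: no workfiles,
2026-08-17) — no `_false_without_<H>` obligation to honour; no dead lines. Negatives index: one refuted statement
on this summit (`UniformPhotonSphereChannels`), unrelated; no stub restates it. Tree facts the stubs lean on (by
name, for the provers): `ChruscielDelay_localConstraintDeformation` (LocalConstraintDeformation.lean),
`MaoOhTao.ObstructionFreeAnnularGluing` (ObstructionFreeGluing.lean — NOT usable at a fixed annulus as `c → 0`:
its smallness is relative to the energy gap), `isTameDataFamily_restrict_of_agree_off_compact`
(TameFamilyOffCompact.lean), `admissibleVacuumData` locality (AdmissibleDataLocality.lean), the coordinate KID rows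
`MetricCoord.adjHamG/adjHamK/adjMomGS/adjMomKS` (CoordConstraintAdjoint.lean, CoordKIDEquations.lean).
-/

noncomputable section

set_option linter.dupNamespace false

namespace Summit.FinalStateConjecture.FinalStateConjecture.Cruxes.TameExitsLocalise.Birth

open scoped Manifold ContDiff Topology
open Literature.Geometry.Lorentzian
open Summit.FinalStateConjecture.FinalStateConjecture.Theses.LaminatedThreshold

/-! ## Vocabulary (definitional abbreviations of the crux's own clauses) -/

section Vocabulary

variable {X : Type} [TopologicalSpace X] [ChartedSpace E3 X] [IsManifold (𝓡 3) ∞ X] [T2Space X]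
  [SecondCountableTopology X] [ConnectedSpace X]

/-- **GOOD datum** — VERBATIM the property whose tame genericity `FinalStateConjecture` asserts (and whose negation
at `d⋆` / assertion at `F c` the crux spells out inline): an MGHD exists, and every MGHD has complete sojourn-`𝓘⁺`
and a sub-extremal, ray-closed, exhaustive, future-oriented final state decomposition with two-Kerr-chart data. -/
def Good (D : InitialDataSet (𝓡 3) X) : Prop :=
  (∃ 𝒟 : VacuumCauchyDevelopment D, 𝒟.IsMaximal) ∧
    ∀ 𝒟 : VacuumCauchyDevelopment D, 𝒟.IsMaximal →
      Summit.FinalStateConjecture.HasCompleteNullInfinity 𝒟.toCauchyDevelopment ∧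
        ∃ (O : Set 𝒟.carrier) (d : FinalStateDecomposition 𝒟.toSpacetime O 2),
          (∀ i, Kerr.IsSubextremal (d.mass i) (d.spin i)) ∧
            O = Summit.FinalStateConjecture.exteriorOf 𝒟.toCauchyDevelopment d.charted ∧
              Summit.FinalStateConjecture.RaysStayInClosure 𝒟.toCauchyDevelopment O ∧
                Summit.FinalStateConjecture.HasExhaustiveCharts d ∧
                  Summit.FinalStateConjecture.IsFutureOriented d

/-- **A non-trivial chart KID on the annulus `{R₁ < ‖y‖ < R₂}` of the end `e` for the datum `D`**: smooth
`N : ℝ³ → ℝ`, `Y : ℝ³ → ℝ³` on the open chart annulus, not both vanishing somewhere on it, solving the Killing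
initial data equations = the kernel equations of the formal adjoint `DΦ*` of the linearised constraint map at the
chart components `(hCoeff e D, kCoeff e D)` (Chruściel–Delay 2003 §2; Moncrief 1975: on a vacuum datum these are
exactly the normal–tangential splittings of Killing fields of the domain of dependence of the annulus). -/
def HasChartKID (e : AFEnd X) (D : InitialDataSet (𝓡 3) X) (R₁ R₂ : ℝ) : Prop :=
  ∃ (N : E3 → ℝ) (Y : E3 → E3),
    ContDiffOn ℝ ∞ N {y : E3 | R₁ < ‖y‖ ∧ ‖y‖ < R₂} ∧
    ContDiffOn ℝ ∞ Y {y : E3 | R₁ < ‖y‖ ∧ ‖y‖ < R₂} ∧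
    (∃ y : E3, R₁ < ‖y‖ ∧ ‖y‖ < R₂ ∧ (N y ≠ 0 ∨ Y y ≠ 0)) ∧
    ∀ y : E3, R₁ < ‖y‖ → ‖y‖ < R₂ →
      MetricCoord.adjHamG (e.hCoeff D) (e.kCoeff D) N y
          + MetricCoord.adjMomGS (e.hCoeff D) (e.kCoeff D) Y y = 0 ∧
        MetricCoord.adjHamK (e.hCoeff D) (e.kCoeff D) N y + MetricCoord.adjMomKS (e.hCoeff D) Y y = 0

/-- **No Killing tail**: beyond every radius the end `e` carries a chart annulus `{R₁ < ‖y‖ < R₂}`, `R₁ ≥ e.R`,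
free of non-trivial KIDs of `D` (the hypothesis under which implicit-function gluing across that annulus is
unobstructed: Chruściel–Delay 2003 Thm 5.9 / Corvino–Schoen 2006 Thm 2). Its negation says that from some radius
on EVERY annulus carries a KID — the tail of `D` is Killing-symmetric near spatial infinity. -/
def NoKillingTail (e : AFEnd X) (D : InitialDataSet (𝓡 3) X) : Prop :=
  ∀ R₀ : ℝ, ∃ R₁ R₂ : ℝ, R₀ ≤ R₁ ∧ e.R ≤ R₁ ∧ R₁ < R₂ ∧ ¬ HasChartKID e D R₁ R₂

end Vocabulary

/-! ## The stub statements -/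

/-- **S1 — PARAMETRIC TAIL GLUING across a KID-free far annulus (elliptic half).** For an admissible `d⋆` with
tame, immersed, injective, admissible exit family `F` on the sole end `e` and NO Killing tail: beyond every `R₀`
there are `R₁ ≥ R₀`, a family `F'` and `ε₁ > 0` with `F'` jointly smooth, immersed at `0`, through `d⋆`,
injective, admissible, equal to `d⋆` off ONE compact set, and equal to `F c` off `e.far R₁` (i.e. inside radius
`R₁`) whenever `‖c‖ < ε₁`. -/
def ParametricTailGluing : Prop :=
  ∀ (X : Type) [TopologicalSpace X] [ChartedSpace E3 X] [IsManifold (𝓡 3) ∞ X] [T2Space X]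
    [SecondCountableTopology X] [ConnectedSpace X] (e : AFEnd X) (dstar : InitialDataSet (𝓡 3) X)
    (F : EuclideanSpace ℝ (Fin 1) → InitialDataSet (𝓡 3) X),
    dstar ∈ admissibleVacuumData X →
    InitialDataSet.IsTameDataFamily e 1 F → InitialDataSet.IsImmersedAtZero 1 F → F 0 = dstar →
    Function.Injective F → (∀ c, F c ∈ admissibleVacuumData X) →
    NoKillingTail e dstar →
    ∀ R₀ : ℝ, ∃ R₁ : ℝ, R₀ ≤ R₁ ∧
      ∃ (F' : EuclideanSpace ℝ (Fin 1) → InitialDataSet (𝓡 3) X) (ε₁ : ℝ),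
        InitialDataSet.IsSmoothDataFamily 1 F' ∧ InitialDataSet.IsImmersedAtZero 1 F' ∧ F' 0 = dstar ∧
        Function.Injective F' ∧ (∀ c, F' c ∈ admissibleVacuumData X) ∧
        (∃ C : Set X, IsCompact C ∧
          ∀ c, ∀ x ∉ C, (F' c).h.inner x = dstar.h.inner x ∧ (F' c).k x = dstar.k x) ∧
        0 < ε₁ ∧
        ∀ c, ‖c‖ < ε₁ → ∀ x ∉ e.far R₁, (F' c).h.inner x = (F c).h.inner x ∧ (F' c).k x = (F c).k x

/-- **S2 — GOODNESS IS TAIL-ROBUST ALONG A TAME EXIT (hyperbolic half; the analytic heart).** For an admissible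
`d⋆` and a tame admissible family `F` through `d⋆` on `e` whose members `c ≠ 0` are good there is a threshold
radius `R⋆` such that for every `R₁ ≥ R⋆`, every jointly smooth admissible family `F'` through `d⋆` which equals
`d⋆` off a compact set and equals `F c` off `e.far R₁` for all small `c` is good on a punctured window
`0 < ‖c‖ < ε`. -/
def GoodnessTailRobust : Prop :=
  ∀ (X : Type) [TopologicalSpace X] [ChartedSpace E3 X] [IsManifold (𝓡 3) ∞ X] [T2Space X]
    [SecondCountableTopology X] [ConnectedSpace X] (e : AFEnd X) (dstar : InitialDataSet (𝓡 3) X)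
    (F : EuclideanSpace ℝ (Fin 1) → InitialDataSet (𝓡 3) X),
    dstar ∈ admissibleVacuumData X →
    InitialDataSet.IsTameDataFamily e 1 F → F 0 = dstar → (∀ c, F c ∈ admissibleVacuumData X) →
    (∀ c, c ≠ 0 → Good (F c)) →
    ∃ Rstar : ℝ, ∀ R₁ : ℝ, Rstar ≤ R₁ →
      ∀ F' : EuclideanSpace ℝ (Fin 1) → InitialDataSet (𝓡 3) X,
        InitialDataSet.IsSmoothDataFamily 1 F' → F' 0 = dstar → (∀ c, F' c ∈ admissibleVacuumData X) →
        (∃ C : Set X, IsCompact C ∧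
          ∀ c, ∀ x ∉ C, (F' c).h.inner x = dstar.h.inner x ∧ (F' c).k x = dstar.k x) →
        (∃ ε₁ : ℝ, 0 < ε₁ ∧
          ∀ c, ‖c‖ < ε₁ → ∀ x ∉ e.far R₁, (F' c).h.inner x = (F c).h.inner x ∧ (F' c).k x = (F c).k x) →
        ∃ ε : ℝ, 0 < ε ∧ ∀ c, c ≠ 0 → ‖c‖ < ε → Good (F' c)

/-- **S3 — THE KILLING-TAIL CASE (residual).** At an admissible exceptional `d⋆` whose end `e` carries KIDs on
all far annuli (`¬ NoKillingTail e d⋆`) and which has a tame, immersed, injective, admissible exit `F` on `e`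
with all members `c ≠ 0` good, there is a compactly supported exit: a jointly smooth, immersed, injective,
admissible family through `d⋆`, equal to `d⋆` off one compact set, good on a punctured window. -/
def KillingTailCase : Prop :=
  ∀ (X : Type) [TopologicalSpace X] [ChartedSpace E3 X] [IsManifold (𝓡 3) ∞ X] [T2Space X]
    [SecondCountableTopology X] [ConnectedSpace X] (e : AFEnd X) (dstar : InitialDataSet (𝓡 3) X)
    (F : EuclideanSpace ℝ (Fin 1) → InitialDataSet (𝓡 3) X),
    dstar ∈ admissibleVacuumData X → ¬ Good dstar →
    InitialDataSet.IsTameDataFamily e 1 F → InitialDataSet.IsImmersedAtZero 1 F → F 0 = dstar →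
    Function.Injective F → (∀ c, F c ∈ admissibleVacuumData X) → (∀ c, c ≠ 0 → Good (F c)) →
    ¬ NoKillingTail e dstar →
    ∃ F' : EuclideanSpace ℝ (Fin 1) → InitialDataSet (𝓡 3) X,
      InitialDataSet.IsSmoothDataFamily 1 F' ∧ InitialDataSet.IsImmersedAtZero 1 F' ∧ F' 0 = dstar ∧
      Function.Injective F' ∧ (∀ c, F' c ∈ admissibleVacuumData X) ∧
      (∃ C : Set X, IsCompact C ∧
        ∀ c, ∀ x ∉ C, (F' c).h.inner x = dstar.h.inner x ∧ (F' c).k x = dstar.k x) ∧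
      ∃ ε : ℝ, 0 < ε ∧ ∀ c, c ≠ 0 → ‖c‖ < ε → Good (F' c)

/-! ## The stubs S1–S3 (the only `sorry`s of the file) -/

/-- **S1 `stub_parametricTailGluing`** — size L (known technology, not printed in this parametric form). WHY
PLAUSIBLY TRUE: on the compact closed chart annulus `Ā = {R₁ ≤ r ≤ R₂}` the members `F c` converge to `d⋆` in
every `C^k` as `c → 0` by JOINT SMOOTHNESS of `(c, x) ↦ (h_c, k_c)` alone; the cut-off interpolation
`χ F c + (1 − χ) d⋆` violates the constraints only inside `A`, by an amount `O(c)` in `C^k`; with NO KIDs of `d⋆`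
on `A` the constraint map at `d⋆` is a submersion on the exponentially weighted spaces of corrections supported in
`Ā` (ChruscielDelay2003 Thm 5.9 / Prop 5.10 / Cor 5.11; ChruscielDelay2004 Thm 6.6; CorvinoSchoen2006 Thm 2), so
the implicit function theorem with parameter `c` gives smooth corrections `δ(c)`, `δ(0) = 0`, supported in `Ā`,
jointly smooth after elliptic bootstrapping (the same routine-but-unprinted assembly as steps (i)–(iv) of the
vendored `ChruscielDelay_localConstraintDeformation`). The glued datum is `F c` inside `R₁`, `d⋆` beyond `R₂`
(so `= d⋆` off the compact set `(e.far R₂)ᶜ`, sole end), vacuum everywhere, complete and DR-flat because its tail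
IS `d⋆`'s (admissibility is local off the gluing region: AdmissibleDataLocality.lean). Immersion at `0`: push `R₁`
beyond a point where the tangent `∂_c F(0)` is non-zero (it exists by `IsImmersedAtZero 1 F`; every point of `X`
has bounded chart radius), so `∂_c F'(0) = ∂_c F(0) ≠ 0` there; injectivity: `c ↦ F' c (x₀)(u, w)` is then
strictly monotone on a window, and the whole line is folded into that window by a smooth injective squash
`φ` with `φ = id` near `0` (so the core-agreement clause keeps the SAME parameter). WHY IT MIGHT FAIL: only
through the fine print — uniformity of the IFT neighbourhood in `c` needs the annulus KID-free for `d⋆` itself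
(granted by `NoKillingTail`) and closeness in the weighted Hölder norms (granted on a COMPACT annulus by joint
smoothness; tameness is not even used here). Leans on: `ChruscielDelay_localConstraintDeformation` (pattern),
`InitialDataSet.IsSmoothDataFamily`, `AFEnd.far`, `AFEnd.IsSoleEnd`, AdmissibleDataLocality.lean.
[ChruscielDelay2003 Thm 5.9, Cor 5.11; ChruscielDelay2004 Thm 6.6; CorvinoSchoen2006 Thm 2; CarlottoSchoen2014] -/
theorem stub_parametricTailGluing : ParametricTailGluing := by
  sorry

/-- **S2 `stub_goodnessTailRobust`** — OPEN (hardest; the crux's analytic heart = the header's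
`TailRobustOfGoodness`). WHY PLAUSIBLY TRUE: `F' c − F c` vanishes inside `R₁`; on the compact annulus it tends
to `0` in every `C^k` as `c → 0` (both families are jointly smooth through `d⋆`); beyond the compact set it equals
`d⋆ − F c`, which tends to `0` in the Dafermos–Rodnianski weighted `C² × C¹` distance of `e` by TAMENESS
(`e.wDist (F c) (F 0) → 0`, continuous mass). So `F' c` is `F c` plus an incoming perturbation that is small in
the weighted energy norms AND supported outside radius `R₁`: by domain of dependence the developments agree on
`D⁺(B_{R₁})`; exterior/far-region Cauchy stability (KlainermanNicolo2003; StabilityCauchy.lean,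
StabilityCauchyCollar.lean; Shen2022 = arXiv:2211.15230 for large interiors) carries the perturbation to a late
hyperboloid, after which it meets the SETTLED sub-extremal configuration of the good member `F c` as weak
incoming radiation, absorbed by asymptotic stability of sub-extremal Kerr (KlainermanSzeftel2023,
GiorgiKlainermanSzeftel2022 for `|a| ≪ M`; DafermosHolzegelRodnianskiTaylor2021 for `a = 0`; conjectural in the
full range) — provided `R₁ ≥ R⋆` is beyond the region where the exceptional behaviour of `d⋆` is decided, UNIFORMLY
in small `c` (transversality reading: the exit tangent `∂_c F(0)` keeps a non-zero component across the exceptional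
set after its tail beyond `R⋆` is removed). WHY IT MIGHT FAIL: (i) full sub-extremal Kerr stability and the
"finitely many Kerrs moving apart" stability are open; (ii) the near-critical phase of `F c` lengthens like
`|log ‖c‖|` as `c → 0` while the perturbation arrives at time `∼ R₁` — robustness uniform in `c` at FIXED `R₁` is
exactly the claim that exceptionality is decided in a bounded region ("false if an exceptional datum exits only via
its tail", the crux's own why-might-fail; refuter's extremal-threshold test case, AretakisInstability). Leans on:
`InitialDataSet.IsTameDataFamily`, `AFEnd.wDist`, StabilityCauchy.lean, the Kerr-stability cite facts.
[KlainermanSzeftel2023; GiorgiKlainermanSzeftel2022; DafermosHolzegelRodnianskiTaylor2021; KlainermanNicolo2003;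
Shen2022; ChristodoulouKlainerman1993] -/
theorem stub_goodnessTailRobust : GoodnessTailRobust := by
  sorry

/-- **S3 `stub_killingTailCase`** — OPEN / SUSPECT (the residual case, deliberately isolated). WHY IT IS A
SEPARATE CASE: if every far annulus of `d⋆` carries a KID then (Moncrief1975 §III; BeigChrusciel1996, BeigChrusciel1997) the
tail of `d⋆` is a slice of a vacuum end with a Killing field, asymptotically a time translation and/or a rotation
(positive mass excludes boosts and spatial translations), and the linearised gluing of S1 is obstructed by the
corresponding KID charge read through the annulus (energy / axial angular momentum): a member `F c` can be joined
to the EXACT tail of `d⋆` only if its charge matches `d⋆`'s to leading order, which fails for every `c ≠ 0` as soon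
as the charge moves along the exit (`M'(0) ≠ 0`); obstruction-free gluing (MaoOhTao2023 Thm 1.7,
CzimekRodnianski2022 = arXiv:2210.09663) needs smallness RELATIVE to the energy gap and hence a gluing radius
`R(c) → ∞` as `c → 0`, incompatible with ONE compact set. WHY PLAUSIBLY TRUE NONETHELESS: no mechanism is known by
which exceptionality of a vacuum datum is forced by its asymptotic charges alone (a compactly supported kick keeps
`(M, J)` but may rearrange the core at will within the mass budget; `|J| > M²` does not obstruct a sub-extremal end
state outside axisymmetry since `J` radiates), so in the transversal picture a LOCAL kick in the core still exits;
the stub then asks for the full content of the crux on this subclass, with the extra structure of an analytic,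
multipole-parametrised Killing tail (Müller zum Hagen; Bäckdahl–Herberthson) to work with. WHY IT MIGHT FAIL (the
disprover's target): an exceptional admissible datum, Kerr (or stationary-axisymmetric) outside a compact set,
every admissible local kick of which stays exceptional while a charge-moving tame deformation cures it — e.g. a
near-extremal axisymmetric threshold where sub-extremality of the end state is pinned by `(M, J)` at infinity
(refuter's note on item 16894; Dain's `m ≥ √|J|`; KehleUnger2024-type extremal thresholds). Leans on: the chart
KID rows `MetricCoord.adjHamG/adjHamK/adjMomGS/adjMomKS`, `AFEnd.hCoeff/kCoeff`.
[Moncrief1975 §III; BeigChrusciel1996; BeigChrusciel1997; BeigChruscielSchoen2004; MaoOhTao2023 Thm 1.7;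
CzimekRodnianski2022] -/
theorem stub_killingTailCase : KillingTailCase := by
  sorry

/-! ## Name-keyed aliases of the three statements — the hypotheses of `TameExitsLocalise_of`

The native skeleton audit (`#h21_check_skeleton`, run by `ledger skeleton check`) admits a hypothesis of the
composing theorem only if its head constant is a registered obligation or is NAMED like a declared stub;
`__Registered.stub_X` is statement `X` under the registered stub's short name (device of
`Cruxes/BandFromNonradiation/Lines/birth.lean`). Each alias is an `abbrev`, definitionally its statement. -/
namespace __Registered

/-- Alias of `ParametricTailGluing` keyed by the registered stub name. -/
abbrev stub_parametricTailGluing : Prop := ParametricTailGluing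
/-- Alias of `GoodnessTailRobust` keyed by the registered stub name. -/
abbrev stub_goodnessTailRobust : Prop := GoodnessTailRobust
/-- Alias of `KillingTailCase` keyed by the registered stub name. -/
abbrev stub_killingTailCase : Prop := KillingTailCase

end __Registered

/-! ## Proved: the vocabulary is the crux; the composition -/

/-- **The vocabulary is DEFINITIONALLY the crux**: `TameExitsLocalise` with the goodness property folded into
`Good`. -/
theorem tameExitsLocalise_iff :
    TameExitsLocalise ↔
      ∀ (X : Type) [TopologicalSpace X] [ChartedSpace E3 X] [IsManifold (𝓡 3) ∞ X] [T2Space X]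
        [SecondCountableTopology X] [ConnectedSpace X],
        ∀ dstar ∈ admissibleVacuumData X, ¬ Good dstar →
          (∃ (e : AFEnd X) (F : EuclideanSpace ℝ (Fin 1) → InitialDataSet (𝓡 3) X),
            InitialDataSet.IsTameDataFamily e 1 F ∧ InitialDataSet.IsImmersedAtZero 1 F ∧ F 0 = dstar ∧
            Function.Injective F ∧ (∀ c, F c ∈ admissibleVacuumData X) ∧ ∀ c, c ≠ 0 → Good (F c)) →
          ∃ F' : EuclideanSpace ℝ (Fin 1) → InitialDataSet (𝓡 3) X,
            InitialDataSet.IsSmoothDataFamily 1 F' ∧ InitialDataSet.IsImmersedAtZero 1 F' ∧ F' 0 = dstar ∧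
            Function.Injective F' ∧ (∀ c, F' c ∈ admissibleVacuumData X) ∧
            (∃ C : Set X, IsCompact C ∧
              ∀ c, ∀ x ∉ C, (F' c).h.inner x = dstar.h.inner x ∧ (F' c).k x = dstar.k x) ∧
            ∃ ε : ℝ, 0 < ε ∧ ∀ c, c ≠ 0 → ‖c‖ < ε → Good (F' c) :=
  Iff.rfl

/-! ## The composition: `TameExitsLocalise` from S1–S3 (kernel-checked; no `sorry` of its own) -/

/-- **`TameExitsLocalise` from the three stub statements.** Given the crux's hypotheses at `(X, d⋆)` with the
tame exit `(e, F)`: if `e` has no Killing tail for `d⋆`, S2 yields the threshold radius `R⋆`, S1 (fed `R₀ := R⋆`)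
the radius `R₁ ≥ R⋆`, the glued local family `F'` and its core-agreement window `ε₁`, and S2 at `R₁` the goodness
window `ε`; otherwise S3 is the crux on the Killing-tail subclass. -/
theorem TameExitsLocalise_of :
    __Registered.stub_parametricTailGluing → __Registered.stub_goodnessTailRobust →
      __Registered.stub_killingTailCase → TameExitsLocalise := by
  intro hglue hrobust hkill X _ _ _ _ _ _ dstar hD hbad hexit
  obtain ⟨e, F, hF, himm, h0, hinj, hadm, hgood⟩ := hexit
  by_cases htail : NoKillingTail e dstar
  · -- KID-free far annuli: glue beyond the robustness threshold, then read off the window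
    obtain ⟨Rstar, hR⟩ := hrobust X e dstar F hD hF h0 hadm hgood
    obtain ⟨R₁, hR₁, F', ε₁, hF', himm', h0', hinj', hadm', hC', hε₁, hcore⟩ :=
      hglue X e dstar F hD hF himm h0 hinj hadm htail Rstar
    obtain ⟨ε, hε, hwin⟩ := hR R₁ hR₁ F' hF' h0' hadm' hC' ⟨ε₁, hε₁, hcore⟩
    exact ⟨F', hF', himm', h0', hinj', hadm', hC', ε, hε, hwin⟩
  · -- Killing tail: the residual stub
    exact hkill X e dstar F hD hbad hF himm h0 hinj hadm hgood htail

/-- WIRING CHECK: the three sorried stubs compose to a closed term of the crux's type (modulo their `sorry`s).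
Deliberately an `example` (no constant enters the environment), so that a BC3 probe cannot close
`stub → TameExitsLocalise` by `exact?` through a pre-composed witness. -/
example : TameExitsLocalise :=
  TameExitsLocalise_of stub_parametricTailGluing stub_goodnessTailRobust stub_killingTailCase

end Summit.FinalStateConjecture.FinalStateConjecture.Cruxes.TameExitsLocalise.Birth

end
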